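import Summits.AtomisticToContinuum.Crystallization.Theorems.PerronTransitivityFractionalGainGivesTransitivity
import Summits.AtomisticToContinuum.Crystallization.Theorems.ThreeConeCertificateDefectVanishCrystallizes

/-!
# Crux `TransitiveLocalLimit` (stmt-AtomisticToContinuum-15100), line `registered`:
# the positional hinge `BulkDefectVanish` (stmt-AtomisticToContinuum-0751) gives stub 1 and the crux

A second in-tree reduction of the only open stub `stub_superBoundSparse` of the registered skeleton
`Cruxes/TransitiveLocalLimit/Lines/birth.lean` (the first being K* = `NoFractionalGain`,
`superBoundSparse_of_noFractionalGain`): the shared positional hinge `BulkDefectVanish` (item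
stmt-AtomisticToContinuum-0751; identical `def`s in the routes ThreeConeCertificate, CrystalThreeCone,
CrystalKissingRigidity, PRVarianceCertificate) — ONE periodic configuration `P` of `ℝ³` such that for
every window radius `R` and tolerance `ε`, along every sequence of Lennard-Jones ground states all but
`o(N)` particles `i` admit a linear isometry `A` with the particles of `B_R(x_i)` two-way `ε`-matched
to `x_i + A(P.points ∩ B_R)` — implies

* `superBoundSparse_of_bulkDefectVanish'` / `superBoundSparse_of_bulkDefectVanish`: the registered
  signature of `stub_superBoundSparse` (no density of `θ`-super-bound sites), and hence
* `transitiveLocalLimit_of_bulkDefectVanish : BulkDefectVanish → TransitiveLocalLimit`, by the landed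
  composition `TransitiveLocalLimit_of_parts` and the landed stubs 2–4.

So the crux stmt-15100 closes by modus ponens when EITHER stmt-15098 (K*) OR stmt-0751 lands.

PROOF ([folklore] throughout; `U_P := Σ'_{q ∈ P.points, q ≠ 0} V_LJ(|q|)`, the site energy of `P`
at the origin).
1. CONTINUITY UNDER ROOTED MATCHING (`exists_forall_rootedMatch_abs_sub_le`): for `δ, θ > 0` there
   are `R, ε > 0` such that every particle `i` of every `δ`-separated finite configuration whose `R`-ball
   is two-way `ε`-matched to `x_i + A(P.points ∩ B_R)` for some linear isometry `A` has
   `|𝓔ⁱ − U_P| ≤ θ`.  By contradiction and compactness: bad instances at scales `(k+1, 1/(k+1))`,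
   recentred at the bad particle, are matched to `A_k(P)`; along a subsequence `A_k → B`
   (`eventually_matched_isometryImage`, compactness of `O(3)`), so the recentred configurations converge
   locally to `X = B(P).points` (uniformly discrete, `exists_pos_le_dist`; `0 ∈ X` because the bad
   particle sits at `0` and is matched at every tolerance); the LANDED stub 4
   `stub_siteEnergyContinuity` at `p = 0` then puts the bad particles' site energies within `θ/2` of
   `U_X(0) = U_P` (isometry invariance of the site sum) — contradiction.
2. DENSITY (`tendsto_density_far_siteEnergyOrigin`): with the uniform minimal distance of ground states
   (`LennardJonesMinimalDistance_holds`), `θ`-far sites (`θ < |𝓔ⁱ − U_P|`) are `(R, ε)`-bad, so their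
   density tends to `0` by the hinge.
3. LEVEL (`siteEnergyOrigin_eq_two_mul_iInf`): along one ground-state sequence
   (`LennardJonesGroundStatesExist_holds`), `|2E(N)/N − U_P| ≤ θ + (C + |U_P|)·#far/N` (pinned sum
   `Σ_i 𝓔ⁱ = 2E(N)`, `|𝓔ⁱ| ≤ C` on separated configurations), and `E(N)/N → E*`
   (`ChargedEnergyGapNegative.crysEnergyLimit`), so `U_P = 2E*`.
4. Super-bound sites `𝓔ⁱ ≤ 2E* − θ` are `θ/2`-far from `U_P = 2E*`.
-/

noncomputable section

namespace Summit.AtomisticToContinuum.Crystallization.Theorems.TransitiveLocalLimitBirth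

open Literature.MathematicalPhysics.StatisticalMechanics Filter Topology
open Summit.AtomisticToContinuum.Crystallization.Theorems.ThreeConeCertificateDefectVanishCrystallizes

/-- A point approximable to every tolerance by points of a uniformly discrete set belongs to the set.
[folklore] -/
theorem mem_of_forall_exists_dist_le {X : Set (EuclideanSpace ℝ (Fin 3))} {ρ : ℝ} (hρ : 0 < ρ)
    (hX : ∀ p ∈ X, ∀ q ∈ X, p ≠ q → ρ ≤ dist p q) {a : EuclideanSpace ℝ (Fin 3)}
    (ha : ∀ ε : ℝ, 0 < ε → ∃ s ∈ X, dist a s ≤ ε) : a ∈ X := by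
  obtain ⟨s₁, hs₁, h₁⟩ := ha (ρ / 3) (by positivity)
  suffices h : a = s₁ by rw [h]; exact hs₁
  refine eq_of_forall_dist_le fun ε hε => ?_
  obtain ⟨s, hs, h⟩ := ha (min ε (ρ / 3)) (lt_min hε (by positivity))
  have hss : s = s₁ := by
    by_contra hne
    have h3 := hX s hs s₁ hs₁ hne
    have h4 : dist s s₁ ≤ dist a s + dist a s₁ := dist_triangle_left _ _ _
    linarith [h.trans (min_le_right _ _)]
  subst hss
  exact h.trans (min_le_left _ _)

/-- The site energy of a periodic configuration at the origin is invariant under linear isometries: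
`Σ'_{q ∈ B(P), q ≠ 0} V_LJ(|q|) = Σ'_{q ∈ P, q ≠ 0} V_LJ(|q|)`. [folklore] -/
theorem tsum_lennardJones_isometryImage_origin (P : PeriodicConfiguration 3)
    (B : EuclideanSpace ℝ (Fin 3) ≃ₗᵢ[ℝ] EuclideanSpace ℝ (Fin 3)) :
    ∑' q : {q : EuclideanSpace ℝ (Fin 3) // q ∈ (P.isometryImage B).points ∧ q ≠ 0},
        lennardJones (dist 0 q.1) =
      ∑' q : {q : EuclideanSpace ℝ (Fin 3) // q ∈ P.points ∧ q ≠ 0}, lennardJones (dist 0 q.1) := by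
  let e : {q : EuclideanSpace ℝ (Fin 3) // q ∈ P.points ∧ q ≠ 0} ≃
      {q : EuclideanSpace ℝ (Fin 3) // q ∈ (P.isometryImage B).points ∧ q ≠ 0} :=
    B.toEquiv.subtypeEquiv fun q => by
      simp only [ne_eq, PeriodicConfiguration.mem_points_isometryImage]
      simp
  rw [← Equiv.tsum_eq e]
  refine tsum_congr fun q => ?_
  simp [e, Equiv.subtypeEquiv_apply]

/-- **Continuity of site energies under rooted matching** (step 1). For a periodic configuration `P`
of `ℝ³` and `δ, θ > 0` there are `R, ε > 0` such that: whenever a particle `i` of a `δ`-separated finite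
configuration `x` has its `R`-neighbourhood two-way `ε`-matched to `x_i + A(P.points ∩ B̄_R)` for a
linear isometry `A` (the matching predicate of `BulkDefectVanish`, verbatim), its site energy is within
`θ` of the site energy of `P` at the origin. Proof by contradiction: compactness of the isometries
(`eventually_matched_isometryImage`) and the continuity stub `stub_siteEnergyContinuity`. [folklore] -/
theorem exists_forall_rootedMatch_abs_sub_le (P : PeriodicConfiguration 3) {δ θ : ℝ}
    (hδ : 0 < δ) (hθ : 0 < θ) :
    ∃ R ε : ℝ, 0 < R ∧ 0 < ε ∧ ∀ (N : ℕ) (x : Fin N → EuclideanSpace ℝ (Fin 3)),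
      (∀ i j, i ≠ j → δ ≤ dist (x i) (x j)) →
      ∀ (i : Fin N) (A : EuclideanSpace ℝ (Fin 3) →ₗᵢ[ℝ] EuclideanSpace ℝ (Fin 3)),
        (∀ p ∈ P.points, ‖p‖ ≤ R → ∃ j : Fin N, dist (x j) (x i + A p) ≤ ε) →
        (∀ j : Fin N, dist (x j) (x i) ≤ R → ∃ p ∈ P.points, dist (x j) (x i + A p) ≤ ε) →
        |siteEnergy lennardJones x i -
          ∑' q : {q : EuclideanSpace ℝ (Fin 3) // q ∈ P.points ∧ q ≠ 0},
            lennardJones (dist 0 q.1)| ≤ θ := by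
  set U : ℝ := ∑' q : {q : EuclideanSpace ℝ (Fin 3) // q ∈ P.points ∧ q ≠ 0},
    lennardJones (dist 0 q.1) with hU
  by_contra hcon
  push Not at hcon
  -- a bad instance at every scale `k`: radius `k + 1`, tolerance `1 / (k + 1)`
  have hk : ∀ k : ℕ, ∃ (N : ℕ) (x : Fin N → EuclideanSpace ℝ (Fin 3)),
      (∀ i j, i ≠ j → δ ≤ dist (x i) (x j)) ∧
      ∃ (i : Fin N) (A : EuclideanSpace ℝ (Fin 3) →ₗᵢ[ℝ] EuclideanSpace ℝ (Fin 3)),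
        (∀ p ∈ P.points, ‖p‖ ≤ (k : ℝ) + 1 →
          ∃ j : Fin N, dist (x j) (x i + A p) ≤ 1 / ((k : ℝ) + 1)) ∧
        (∀ j : Fin N, dist (x j) (x i) ≤ (k : ℝ) + 1 →
          ∃ p ∈ P.points, dist (x j) (x i + A p) ≤ 1 / ((k : ℝ) + 1)) ∧
        θ < |siteEnergy lennardJones x i - U| :=
    fun k => hcon ((k : ℝ) + 1) (1 / ((k : ℝ) + 1)) (by positivity) (by positivity)
  choose n x hsep i A h1 h2 hbad using hk
  -- recentre at the bad particle
  set τ : ℕ → EuclideanSpace ℝ (Fin 3) := fun k => -x k (i k) with hτ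
  set y : (k : ℕ) → Fin (n k) → EuclideanSpace ℝ (Fin 3) := fun k j => x k j + τ k with hy
  have hdist : ∀ k j q, dist (y k j) q = dist (x k j) (x k (i k) + q) := fun k j q => by
    show dist (x k j + -x k (i k)) q = _
    rw [← dist_add_right (x k j + -x k (i k)) q (x k (i k)), neg_add_cancel_right, add_comm q]
  have hnorm : ∀ k j, ‖y k j‖ = dist (x k j) (x k (i k)) := fun k j => by
    show ‖x k j + -x k (i k)‖ = _
    rw [← sub_eq_add_neg, dist_eq_norm]
  have hy0 : ∀ k, y k (i k) = 0 := fun k => by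
    show x k (i k) + -x k (i k) = 0
    exact add_neg_cancel _
  have hy' : ∀ k : ℕ,
      (∀ p ∈ P.points, ‖p‖ ≤ (k : ℝ) + 1 → ∃ j, dist (y k j) (A k p) ≤ 1 / ((k : ℝ) + 1)) ∧
      (∀ j, ‖y k j‖ ≤ (k : ℝ) + 1 → ∃ p ∈ P.points, dist (y k j) (A k p) ≤ 1 / ((k : ℝ) + 1)) := by
    intro k
    refine ⟨fun p hp hpk => ?_, fun j hj => ?_⟩
    · obtain ⟨j, hj⟩ := h1 k p hp hpk
      exact ⟨j, by rw [hdist]; exact hj⟩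
    · obtain ⟨p, hp, hjp⟩ := h2 k j (by rw [← hnorm]; exact hj)
      exact ⟨p, hp, by rw [hdist]; exact hjp⟩
  -- converging charts: one rotated limit configuration `X = B(P)`
  obtain ⟨ψ, B, hψ, hmatch⟩ := eventually_matched_isometryImage P y A hy'
  set X : Set (EuclideanSpace ℝ (Fin 3)) := (P.isometryImage B).points with hX
  obtain ⟨ρ, hρ, hXsep⟩ := (P.isometryImage B).exists_pos_le_dist
  -- the bad particles sit at the origin, which therefore belongs to `X`
  have h0X : (0 : EuclideanSpace ℝ (Fin 3)) ∈ X := by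
    refine mem_of_forall_exists_dist_le hρ hXsep fun ε hε => ?_
    obtain ⟨l, -, hl⟩ := (hmatch 0 ε hε).exists
    obtain ⟨s, hs, hls⟩ := hl (i (ψ l)) (by rw [hy0, norm_zero])
    exact ⟨s, hs, by rw [hy0] at hls; exact hls⟩
  -- separation passes to the recentred configurations
  have hysep : ∀ (l : ℕ) (j j' : Fin (n (ψ l))), j ≠ j' → δ ≤ dist (y (ψ l) j) (y (ψ l) j') := by
    intro l j j' hjj'
    show δ ≤ dist (x (ψ l) j + τ (ψ l)) (x (ψ l) j' + τ (ψ l))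
    rw [dist_add_right]
    exact hsep (ψ l) j j' hjj'
  -- the landed continuity stub at the limit point `0`
  obtain ⟨ε₀, hε₀, hev⟩ := stub_siteEnergyContinuity (fun l => n (ψ l)) (fun l => y (ψ l)) X δ hδ
    hysep ⟨ρ, hρ, hXsep⟩ hmatch 0 h0X (θ / 2) (half_pos hθ)
  obtain ⟨l, hl⟩ := hev.exists
  have hclose := hl (i (ψ l)) (by rw [hy0, dist_self]; exact hε₀.le)
  -- translate back and identify the limit site energy with `U`
  have htrans : siteEnergy lennardJones (y (ψ l)) (i (ψ l)) =
      siteEnergy lennardJones (x (ψ l)) (i (ψ l)) :=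
    siteEnergy_add_const lennardJones (x (ψ l)) (τ (ψ l)) (i (ψ l))
  have hUX : ∑' q : {q : EuclideanSpace ℝ (Fin 3) // q ∈ X ∧ q ≠ 0}, lennardJones (dist 0 q.1) = U :=
    tsum_lennardJones_isometryImage_origin P B
  rw [htrans, hUX] at hclose
  have := hbad (ψ l)
  linarith

/-- Counting: a decidable property implying another bounds the filtered cardinality by the `Nat.card`
of the subtype. [folklore] -/
theorem card_filter_le_nat_card {N : ℕ} (p q : Fin N → Prop) [DecidablePred p]
    (h : ∀ i, p i → q i) :
    ((Finset.univ.filter p).card : ℝ) ≤ Nat.card {i : Fin N // q i} := by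
  classical
  rw [Nat.card_eq_fintype_card, Fintype.card_subtype]
  exact_mod_cast Finset.card_le_card fun i hi => by
    simp only [Finset.mem_filter, Finset.mem_univ, true_and] at hi ⊢
    exact h i hi

/-- **Density (step 2).** Under the hinge `BulkDefectVanish` for the reference configuration `P`
(hypothesis `hBDV`, the body of the shared item stmt-AtomisticToContinuum-0751 verbatim), along every
sequence of Lennard-Jones ground states and for every `θ > 0` the sites whose site energy is `θ`-far from
the site energy of `P` at the origin have density `→ 0`. [folklore] -/
theorem tendsto_density_far_siteEnergyOrigin (P : PeriodicConfiguration 3)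
    (hBDV : ∀ R ε : ℝ, 0 < R → 0 < ε → ∀ x : (N : ℕ) → (Fin N → EuclideanSpace ℝ (Fin 3)),
      (∀ N, IsGroundState lennardJones (x N)) →
      Tendsto (fun N : ℕ => (Nat.card {i : Fin N // ¬ ∃ A : EuclideanSpace ℝ (Fin 3) →ₗᵢ[ℝ]
        EuclideanSpace ℝ (Fin 3),
        (∀ p ∈ P.points, ‖p‖ ≤ R → ∃ j : Fin N, dist (x N j) (x N i + A p) ≤ ε) ∧
        (∀ j : Fin N, dist (x N j) (x N i) ≤ R → ∃ p ∈ P.points, dist (x N j) (x N i + A p) ≤ ε)}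
          : ℝ) / N) atTop (𝓝 0))
    (x : (N : ℕ) → (Fin N → EuclideanSpace ℝ (Fin 3))) (hx : ∀ N, IsGroundState lennardJones (x N))
    {θ : ℝ} (hθ : 0 < θ) :
    Tendsto (fun N : ℕ => ((Finset.univ.filter fun i : Fin N =>
      θ < |siteEnergy lennardJones (x N) i -
        ∑' q : {q : EuclideanSpace ℝ (Fin 3) // q ∈ P.points ∧ q ≠ 0},
          lennardJones (dist 0 q.1)|).card : ℝ) / N) atTop (𝓝 0) := by
  obtain ⟨δ, hδ, hδsep⟩ := LennardJonesMinimalDistance_holds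
  obtain ⟨R, ε, hR, hε, hgood⟩ := exists_forall_rootedMatch_abs_sub_le P hδ hθ
  have ht := hBDV R ε hR hε x hx
  refine squeeze_zero (fun N => by positivity) (fun N => ?_) ht
  refine div_le_div_of_nonneg_right ?_ (Nat.cast_nonneg N)
  refine card_filter_le_nat_card _ _ fun i hi hA => ?_
  obtain ⟨A, hA1, hA2⟩ := hA
  have := hgood N (x N) (hδsep N (x N) (hx N)) i A hA1 hA2
  linarith

/-- Book-keeping for the pinned average: if `|u i| ≤ C` for all `i` and `η ≥ 0`, then
`|Σ_i u i − N·L| ≤ η·N + (C + |L|)·#{i : η < |u i − L|}`. [folklore] -/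
theorem abs_sum_sub_le_card_filter {N : ℕ} (u : Fin N → ℝ) {L C η : ℝ} (hη : 0 ≤ η)
    (hC : ∀ i, |u i| ≤ C) :
    |∑ i, u i - N * L| ≤
      η * N + (C + |L|) * ((Finset.univ.filter fun i => η < |u i - L|).card : ℝ) := by
  rw [Finset.natCast_card_filter, Finset.mul_sum]
  have hN : (N : ℝ) * L = ∑ _i : Fin N, L := by simp
  have hN' : η * (N : ℝ) = ∑ _i : Fin N, η := by simp [mul_comm]
  rw [hN, hN', ← Finset.sum_sub_distrib, ← Finset.sum_add_distrib]
  refine (Finset.abs_sum_le_sum_abs _ _).trans (Finset.sum_le_sum fun i _ => ?_)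
  have h1 := hC i
  have h2 : |u i - L| ≤ |u i| + |L| := abs_sub _ _
  split_ifs with h
  · linarith
  · push Not at h
    linarith

/-- **Level (step 3).** Under the hinge for `P`, the site energy of `P` at the origin equals `2E*`,
`E* = ⨅_Q e_LJ(Q)`: along a ground-state sequence (`LennardJonesGroundStatesExist_holds`) the site
energies concentrate in density at `U_P` (step 2) while their average `2E(N)/N` tends to `2E*`
(`crysEnergyLimit`). [folklore] -/
theorem siteEnergyOrigin_eq_two_mul_iInf (P : PeriodicConfiguration 3)
    (hBDV : ∀ R ε : ℝ, 0 < R → 0 < ε → ∀ x : (N : ℕ) → (Fin N → EuclideanSpace ℝ (Fin 3)),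
      (∀ N, IsGroundState lennardJones (x N)) →
      Tendsto (fun N : ℕ => (Nat.card {i : Fin N // ¬ ∃ A : EuclideanSpace ℝ (Fin 3) →ₗᵢ[ℝ]
        EuclideanSpace ℝ (Fin 3),
        (∀ p ∈ P.points, ‖p‖ ≤ R → ∃ j : Fin N, dist (x N j) (x N i + A p) ≤ ε) ∧
        (∀ j : Fin N, dist (x N j) (x N i) ≤ R → ∃ p ∈ P.points, dist (x N j) (x N i + A p) ≤ ε)}
          : ℝ) / N) atTop (𝓝 0)) :
    ∑' q : {q : EuclideanSpace ℝ (Fin 3) // q ∈ P.points ∧ q ≠ 0}, lennardJones (dist 0 q.1) =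
      2 * ⨅ Q : PeriodicConfiguration 3, Q.energyPerParticle lennardJones := by
  set L : ℝ := ∑' q : {q : EuclideanSpace ℝ (Fin 3) // q ∈ P.points ∧ q ≠ 0},
    lennardJones (dist 0 q.1) with hL
  set E : ℝ := ⨅ Q : PeriodicConfiguration 3, Q.energyPerParticle lennardJones with hE
  choose x hx using LennardJonesGroundStatesExist_holds
  obtain ⟨δ, hδ, hδsep⟩ := LennardJonesMinimalDistance_holds
  set C : ℝ := (δ⁻¹ ^ 6 / 12 + 1 / 6) * (250 * δ⁻¹ ^ 6) with hC
  have hCi : ∀ (N : ℕ) (i : Fin N), |siteEnergy lennardJones (x N) i| ≤ C := fun N i =>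
    (Finset.abs_sum_le_sum_abs _ _).trans
      (sum_abs_lennardJones_erase_le (x N) hδ (fun k l hkl => hδsep N (x N) (hx N) k l hkl) i)
  have hEl : Tendsto (fun N : ℕ => groundStateEnergy lennardJones 3 N / N) atTop (𝓝 E) :=
    ChargedEnergyGapNegative.crysEnergyLimit
  symm
  refine eq_of_forall_dist_le fun θ hθ => ?_
  have hfar := tendsto_density_far_siteEnergyOrigin P hBDV x hx (half_pos hθ)
  -- pointwise in `N ≥ 1`
  have hptw : ∀ N : ℕ, 0 < N →
      |2 * (groundStateEnergy lennardJones 3 N / N) - L| ≤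
        θ / 2 + (C + |L|) * (((Finset.univ.filter fun i : Fin N =>
          θ / 2 < |siteEnergy lennardJones (x N) i - L|).card : ℝ) / N) := by
    intro N hN
    have hNr : (0 : ℝ) < N := by exact_mod_cast hN
    have key := abs_sum_sub_le_card_filter (siteEnergy lennardJones (x N)) (L := L)
      (half_pos hθ).le (hCi N)
    rw [← two_mul_interactionEnergy, (hx N).2] at key
    have h1 : |2 * (groundStateEnergy lennardJones 3 N / N) - L| =
        |2 * groundStateEnergy lennardJones 3 N - N * L| / N := by
      rw [← abs_of_pos hNr, ← abs_div, abs_of_pos hNr]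
      congr 1
      field_simp
    rw [h1, div_le_iff₀ hNr]
    calc |2 * groundStateEnergy lennardJones 3 N - N * L|
        ≤ θ / 2 * N + (C + |L|) * ((Finset.univ.filter fun i : Fin N =>
            θ / 2 < |siteEnergy lennardJones (x N) i - L|).card : ℝ) := key
      _ = (θ / 2 + (C + |L|) * (((Finset.univ.filter fun i : Fin N =>
            θ / 2 < |siteEnergy lennardJones (x N) i - L|).card : ℝ) / N)) * N := by
          field_simp
  have hlim1 : Tendsto (fun N : ℕ => |2 * (groundStateEnergy lennardJones 3 N / N) - L|) atTop
      (𝓝 |2 * E - L|) := ((hEl.const_mul 2).sub_const L).abs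
  have hlim2 : Tendsto (fun N : ℕ => θ / 2 + (C + |L|) * (((Finset.univ.filter fun i : Fin N =>
      θ / 2 < |siteEnergy lennardJones (x N) i - L|).card : ℝ) / N)) atTop
      (𝓝 (θ / 2 + (C + |L|) * 0)) := (hfar.const_mul (C + |L|)).const_add (θ / 2)
  rw [mul_zero, add_zero] at hlim2
  have hle : |2 * E - L| ≤ θ / 2 :=
    le_of_tendsto_of_tendsto hlim1 hlim2 (by
      filter_upwards [eventually_gt_atTop 0] with N hN
      exact hptw N hN)
  rw [Real.dist_eq]
  linarith

/-- **Stub 1 under the positional hinge (general reference configuration).** If `BulkDefectVanish`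
holds for the periodic configuration `P` (hypothesis `hBDV`, the body of item stmt-0751 verbatim), then
along every sequence of Lennard-Jones ground states and for every `θ > 0` the `θ`-super-bound sites
(`𝓔ⁱ ≤ 2E* − θ`) have density `→ 0` — the registered signature of `stub_superBoundSparse`. [folklore] -/
theorem superBoundSparse_of_bulkDefectVanish' (P : PeriodicConfiguration 3)
    (hBDV : ∀ R ε : ℝ, 0 < R → 0 < ε → ∀ x : (N : ℕ) → (Fin N → EuclideanSpace ℝ (Fin 3)),
      (∀ N, IsGroundState lennardJones (x N)) →
      Tendsto (fun N : ℕ => (Nat.card {i : Fin N // ¬ ∃ A : EuclideanSpace ℝ (Fin 3) →ₗᵢ[ℝ]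
        EuclideanSpace ℝ (Fin 3),
        (∀ p ∈ P.points, ‖p‖ ≤ R → ∃ j : Fin N, dist (x N j) (x N i + A p) ≤ ε) ∧
        (∀ j : Fin N, dist (x N j) (x N i) ≤ R → ∃ p ∈ P.points, dist (x N j) (x N i + A p) ≤ ε)}
          : ℝ) / N) atTop (𝓝 0)) :
    ∀ x : (N : ℕ) → (Fin N → EuclideanSpace ℝ (Fin 3)), (∀ N, Literature.MathematicalPhysics.StatisticalMechanics.IsGroundState Literature.MathematicalPhysics.StatisticalMechanics.lennardJones (x N)) → ∀ θ : ℝ, 0 < θ → Filter.Tendsto (fun N : ℕ => ((Finset.univ.filter fun i : Fin N => Literature.MathematicalPhysics.StatisticalMechanics.siteEnergy Literature.MathematicalPhysics.StatisticalMechanics.lennardJones (x N) i ≤ 2 * (⨅ Q : Literature.MathematicalPhysics.StatisticalMechanics.PeriodicConfiguration 3, Q.energyPerParticle Literature.MathematicalPhysics.StatisticalMechanics.lennardJones) - θ).card : ℝ) / N) Filter.atTop (nhds 0) := by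
  intro x hx θ hθ
  have hLE := siteEnergyOrigin_eq_two_mul_iInf P hBDV
  have h := tendsto_density_far_siteEnergyOrigin P hBDV x hx (half_pos hθ)
  rw [hLE] at h
  refine squeeze_zero (fun N => by positivity) (fun N => ?_) h
  refine div_le_div_of_nonneg_right ?_ (Nat.cast_nonneg N)
  exact_mod_cast Finset.card_le_card fun i hi => by
    simp only [Finset.mem_filter, Finset.mem_univ, true_and] at hi ⊢
    rw [abs_of_nonpos (by linarith)]
    linarith

/-- **Stub 1 under the positional hinge** — REGISTERED stub `superBoundSparse_of_bulkDefectVanish` of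
the crux stmt-AtomisticToContinuum-15100: the hypothesis is the body of the shared item
stmt-AtomisticToContinuum-0751 `BulkDefectVanish` VERBATIM (identical `def`s in the routes
ThreeConeCertificate, CrystalThreeCone, CrystalKissingRigidity, PRVarianceCertificate), the conclusion the
registered signature of `stub_superBoundSparse`. [folklore] -/
theorem superBoundSparse_of_bulkDefectVanish : (∃ P : Literature.MathematicalPhysics.StatisticalMechanics.PeriodicConfiguration 3, ∀ R ε : ℝ, 0 < R → 0 < ε → ∀ x : (N : ℕ) → (Fin N → EuclideanSpace ℝ (Fin 3)), (∀ N, Literature.MathematicalPhysics.StatisticalMechanics.IsGroundState Literature.MathematicalPhysics.StatisticalMechanics.lennardJones (x N)) → Filter.Tendsto (fun N : ℕ => (Nat.card {i : Fin N // ¬ ∃ A : EuclideanSpace ℝ (Fin 3) →ₗᵢ[ℝ] EuclideanSpace ℝ (Fin 3), (∀ p ∈ P.points, ‖p‖ ≤ R → ∃ j : Fin N, dist (x N j) (x N i + A p) ≤ ε) ∧ (∀ j : Fin N, dist (x N j) (x N i) ≤ R → ∃ p ∈ P.points, dist (x N j) (x N i + A p) ≤ ε)} : ℝ) / N) Filter.atTop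 (nhds 0)) → ∀ x : (N : ℕ) → (Fin N → EuclideanSpace ℝ (Fin 3)), (∀ N, Literature.MathematicalPhysics.StatisticalMechanics.IsGroundState Literature.MathematicalPhysics.StatisticalMechanics.lennardJones (x N)) → ∀ θ : ℝ, 0 < θ → Filter.Tendsto (fun N : ℕ => ((Finset.univ.filter fun i : Fin N => Literature.MathematicalPhysics.StatisticalMechanics.siteEnergy Literature.MathematicalPhysics.StatisticalMechanics.lennardJones (x N) i ≤ 2 * (⨅ Q : Literature.MathematicalPhysics.StatisticalMechanics.PeriodicConfiguration 3, Q.energyPerParticle Literature.MathematicalPhysics.StatisticalMechanics.lennardJones) - θ).card : ℝ) / N) Filter.atTop (nhds 0) := by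
  rintro ⟨P, hP⟩
  exact superBoundSparse_of_bulkDefectVanish' P hP

/-- **The crux under the positional hinge**: `BulkDefectVanish → TransitiveLocalLimit`, by the landed
composition `TransitiveLocalLimit_of_parts` of the registered line applied to
`superBoundSparse_of_bulkDefectVanish` and the landed stubs 2–4. Hence the crux
stmt-AtomisticToContinuum-15100 closes by modus ponens as soon as the shared hinge stmt-0751 lands
(independently of K* = `NoFractionalGain`). [folklore] -/
theorem transitiveLocalLimit_of_bulkDefectVanish :
    Summit.AtomisticToContinuum.Crystallization.Theses.ThreeConeCertificate.BulkDefectVanish →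
    Summit.AtomisticToContinuum.Crystallization.Theses.PerronTransitivity.TransitiveLocalLimit := by
  unfold Summit.AtomisticToContinuum.Crystallization.Theses.ThreeConeCertificate.BulkDefectVanish
  intro h
  exact TransitiveLocalLimit_of_parts (superBoundSparse_of_bulkDefectVanish h)
    stub_concentration_of_superBoundSparse stub_centredLocalLimit stub_siteEnergyContinuity

end Summit.AtomisticToContinuum.Crystallization.Theorems.TransitiveLocalLimitBirth

end
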